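import Summits.CriticalPhenomena.Ising3DConformalLimit.Theses.PrecisionLaplacian
import Summits.CriticalPhenomena.Ising3DConformalLimit.Theses.PerfectScreening
import Summits.CriticalPhenomena.Ising3DConformalLimit.Theses.IsingEuclidUpgrade
import Summits.CriticalPhenomena.Ising3DConformalLimit.Theorems.PrecisionLaplacianDirectCorrelationStableTailClosureModuloStableScaling
import Summits.CriticalPhenomena.Ising3DConformalLimit.Theorems.PrecisionLaplacianDirectCorrelationStableTailDiffusiveBranch
import Summits.CriticalPhenomena.Ising3DConformalLimit.Theorems.PrecisionLaplacianDirectCorrelationStableTailBoxCapture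
import Summits.CriticalPhenomena.Ising3DConformalLimit.Theorems.PrecisionLaplacianDirectCorrelationStableTailPickInversion
import Summits.CriticalPhenomena.Ising3DConformalLimit.Theorems.PrecisionLaplacianDirectCorrelationStableTailDcfStructure
import Summits.CriticalPhenomena.Ising3DConformalLimit.Theorems.PrecisionLaplacianDirectCorrelationStableTailSlabSpectralRepresentation
import Summits.CriticalPhenomena.Ising3DConformalLimit.Theorems.PrecisionLaplacianPrecisionIsLaplacian
import Summits.CriticalPhenomena.Ising3DConformalLimit.Theorems.PrecisionLaplacianTwoPointSpineGlue
import Summits.CriticalPhenomena.Ising3DConformalLimit.Theorems.PrecisionLaplacianStableConeRPRigidity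
import Literature.Probability.LatticeModels.CriticalTwoPointDCPLowerHolds
import Literature.Probability.LatticeModels.IsingExponentsProofs
import Literature.Probability.LatticeModels.HighDimPointwiseTriviality
import Literature.Probability.LatticeModels.CriticalTwoPointBounds
import Literature.Probability.LatticeModels.CriticalTwoPointLawDimension
import Summits.CriticalPhenomena.Ising3DConformalLimit.Theorems.PrecisionLaplacianDirectCorrelationStableTailExponentWindow
import Summits.CriticalPhenomena.Ising3DConformalLimit.Theorems.PrecisionLaplacianDirectCorrelationStableTailTightness
import Summits.CriticalPhenomena.Ising3DConformalLimit.Theorems.PrecisionLaplacianDirectCorrelationStableTailScaleIdentity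
import Summits.CriticalPhenomena.Ising3DConformalLimit.Theorems.PrecisionLaplacianDirectCorrelationStableTailKernelScaling
import Summits.CriticalPhenomena.Ising3DConformalLimit.Theorems.PrecisionLaplacianDirectCorrelationStableTailRieszGaussian
import Summits.CriticalPhenomena.Ising3DConformalLimit.Theorems.PrecisionLaplacianDirectCorrelationStableTailSymbolIdentification
import HarnessLib

/-!
# Line `diffusive-branch-is-nonsaturation` — crux `PrecisionLaplacian.DirectCorrelationStableTail`
# (stmt-CriticalPhenomena-4799, route PrecisionLaplacian, rank 3) — THE CONVERSE TWO-POINT SPINE, modulo stub S6 (closure of rev c4-1)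
(continuation lead prover-line-stmt-CriticalPhenomena-4799-c4-0, 2026-08-16; continues rev c3-3 of lead c3, whose fifteen stubs
and four glue files are all landed; planner's skeleton: planner-cruxplan-stmt-CriticalPhenomena-4799-diffusive-branch-is--0).

CRUX (by name): `Summit.CriticalPhenomena.Ising3DConformalLimit.Theses.PrecisionLaplacian.DirectCorrelationStableTail`, `H → TAIL`.
`m := dcf` (the crux's inlined `iInf`; `m(0) = −A₀ < 0`, `m = a ≥ 0` off `0`), `G := criticalTwoPoint 3`.

## What rev c3-3 left, and the reshape

Under `H` the tree PROVES: crux ⟺ stable Lévy scaling of `a` (p126257, `directCorrelationStableTail_iff_stableLevyScalingCore`: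
`∃ α ∈ (1,2), Φ ∈ C(S²), Φ ≥ 0, Φ ≢ 0, R^α Σ_x a(x) f(x/R) → ∫ f Φ(ŷ)|y|^{-3-α}` for `f ∈ C_c(ℝ³∖0)`); crux ⟹ NonSaturation (item
1342; p127888); NonSaturation ⟺ `Σ a|x|² = ∞` (p129415).  The one open stub was the residual core `H → Z = 0 → stable Lévy scaling`
(open-problem strength: `η(3) > 0` + pure power + angular regularity).  Rev c4-1 keeps the composition idea (branch decision =
the named item 1342; residual = pure power + angular regularity of the scaling of `a`) and DISCHARGES the residual from the
sub-problem's own two-point item 0634 `IsingEuclidUpgrade.IsingEuclidUpgradeR2RotInvPowerLaw` (isotropic pure power law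
`G(x)|x|₂^{2Δ} → c > 0` — the conclusion of the PROVED route glue 4805 `TwoPointSpineGlue : H → TAIL → … → 0634`):

  `DirectCorrelationStableTail_of_levyContinuity (hNS : NonSaturation) (hR2 : IsingEuclidUpgradeR2RotInvPowerLaw) : crux`,

a CONVERSE two-point spine, so that (with 4805 + proved r4 + proved RP9 + landed D1) under `H`:  crux ⟺ (0634 ∧ 1342)
(`directCorrelationStableTail_iff_twoPointLaw_and_nonSaturation_of_levyContinuity`; in THIS file everything downstream of S6 carries the section
hypothesis `hS6` = the registered statement of `stub_levyContinuityTransfer`, verbatim).  The converse is a MEASURE-LEVEL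
Tauberian theorem (asymptotics of `G` ⇒ scaling of the jump law `a` of the walk whose Green function `G` is); Disproof §7.3 shows
it FALSE for general symmetric-potential kernels (Williamson-type oscillating step laws).  It is TRUE for the critical kernel
through two LANDED Ising inputs: Messager–Miracle-Solé box capture (p127376: tightness of the rescaled jump measures at `∞`, by
the flux identity) and the antitone slab sums from nine-mirror RP + Pick inversion (p99412 + p85632: tightness at `0`); the
passage measure ⇒ pointwise (which kills §5's parity modulation) is the landed closure.  Exponent window: 1342 forces `2Δ > 1`
and the PROVED Duminil-Copin–Panis bound `dcp_isingEta_le_half_holds` forces `2Δ ≤ 3/2`, so `α := 3 − 2Δ ∈ [3/2, 2)`.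

## The seven registered stubs (all Ising-free given their hypotheses; all landed as `Theorems/` files)

* S0 `stub_exponentWindow` (M) — 1342 ∧ 0634 ∧ tree bounds ∧ DCP ⇒ `∃ α ∈ (1,2), c > 0`, `G|x|₂^{3-α} → c`, sup-norm scale bounds.
* S1 `stub_tightness` (M–L) — flux identity + box capture + scale bounds ⇒ `R^α Σ_{‖y‖≥R} a ≤ C`; + antitone slabs ⇒
  `Σ_{‖y‖≤R} a|y|² ≤ C' R^{2-α}`.
* S2 `stub_scaleIdentity` (M) — `m ∗ G = −δ`, `Σ m = 0` ⇒ `Σ_y m(y)(Ψ_R(0) − Ψ_R(y)) = φ(0)`, `Ψ_R = Σ_z φ(z/R)G(z−·)`, `Ψ_R` even.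
* S3 `stub_kernelScaling` (L) — under `G(x)|x|₂^{3-α} → c`: `R^{-α}(Ψ_R(0) − Ψ_R(y)) = c·D_{t,k}(y/R) + o(1)·min(|y/R|²,1)`
  uniformly in `y`, for the Gaussian–cosine tests `φ_{t,k}(v) = e^{-t|v|²}cos(k·v)`, `D_{t,k}(u) = ∫|v|^{α-3}(φ(v) − φ(v+u))dv`.
* S4 `stub_rieszGaussian` (L) — the Riesz–Gaussian oscillatory integral: `D_{t,k}(u) → C_α|k|^{-α}(1 − cos k·u)` as `t → 0⁺`,
  uniformly for `|u| ≤ t^{-1/4}`, to second order for `|u| ≤ 1`, and `|D_{t,k}| ≤ B_k` uniformly (Gamma subordination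
  `|v|^{α-3} = Γ((3-α)/2)⁻¹ ∫ s^{(1-α)/2} e^{-s|v|²} ds` + Gaussian Fourier transform).
* S5 `stub_symbolIdentification` (M–L, LEAD) — S1 ∧ S2 ∧ S3 ∧ S4 ⇒ `R^α ψ(k/R) → c'|k|^α`, `c' = 1/(c C_α)`.
* S6 `stub_levyContinuityTransfer` (L) — symbol convergence + tightness ⇒ `R^α Σ a(x) f(x/R) → ∫ f Φ₀|y|^{-3-α}`
  (Mathlib `ProbabilityMeasure.tendsto_iff_tendsto_charFun`, weight `1 − e^{-|u|²/2}`).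

DISPROOF USED (`Cruxes/DirectCorrelationStableTail/Disproof.lean`, cycle 2, re-read 2026-08-16T23:30Z; no `-- Targets`, no
`Negative/`): §2/§3 — `δ₀` fails 0634, `G₀ = latticeGreen/2` satisfies 0634 with `2Δ = 1` and is excluded by 1342 (the separating
input is again NonSaturation, consistently with c2/c3); §5/§7.3 — the converse Tauberian is NOT claimed as a schema: S1 uses box
capture (MMS) and the antitone slab sums (RP9 + Pick), and measure ⇒ pointwise is the landed closure; §6 — every stub is covariant
under `a ↦ λa`, `G ↦ G/λ`; §7.4 — the `Z = 0` branch is forced by 1342 ∧ 0634 (S0: `α < 2`).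

Namespace `…Cruxes.DirectCorrelationStableTail.DiffusiveBranchIsNonsaturation` (as rev c2/c3).  Pure theorem file (no
definitions, no `sorry`): the composition and the headline equivalence; the stubs are the imported tree theorems.
-/

noncomputable section

namespace Summit.CriticalPhenomena.Ising3DConformalLimit.Cruxes.DirectCorrelationStableTail.DiffusiveBranchIsNonsaturation

open MeasureTheory Filter Topology
open scoped BigOperators
open Literature.Probability.LatticeModels
open Summit.CriticalPhenomena.Ising3DConformalLimit.Theses

/-! ## The registered stubs: S0–S5 LANDED (imported above, same namespace); S6 is the section hypothesis `hS6` below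

* S0 `stub_exponentWindow` — p131205, `Theorems/PrecisionLaplacianDirectCorrelationStableTailExponentWindow.lean`
* S1 `stub_tightness` — p132101 (+ aux p131962), `…Tightness.lean`, `…TightnessAux.lean`
* S2 `stub_scaleIdentity` — p132220, `…ScaleIdentity.lean`
* S3 `stub_kernelScaling` — p135417 (+ aux p133970 p134755 p134833 p134834 p134757 p135253 p135167), `…KernelScaling(Aux…Aux7).lean`
* S4 `stub_rieszGaussian` — p136825 (+ aux p135969 p136398 p136650 p136651), `…RieszGaussian(Aux…Aux4).lean`
* S5 `stub_symbolIdentification` — p137860 (lead), `…SymbolIdentification.lean` (+ aux p137482 `…SymbolIdentificationAux.lean`, p137661 `…SymbolIdentificationAux2.lean`)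
* S6 `stub_levyContinuityTransfer` — registered, in progress at the time of writing (statement = `hS6` verbatim)
-/

/-! ## The proved direction: under `H`, crux ⇒ 0634 (route glue 4805) and the axis form of the two-point law -/

/-- Under `H`, the crux gives back item 0634 (the proved route glue `TwoPointSpineGlue`, item 4805, with the proved crux r4
`StableConeRPRigidity` and the proved nine-mirror RP item 1985). -/
theorem twoPointLaw_of_directCorrelationStableTail (hH : ∀ A : Finset (Site 3), (Matrix.of fun (p q : ↥A) => criticalTwoPoint 3 (q.1 - p.1)).PosDef ∧
      ∀ u v : ↥A, (u ≠ v → (Matrix.of fun (p q : ↥A) => criticalTwoPoint 3 (q.1 - p.1))⁻¹ u v ≤ 0) ∧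
        0 ≤ ∑ w, (Matrix.of fun (p q : ↥A) => criticalTwoPoint 3 (q.1 - p.1))⁻¹ u w)
    (hT : PrecisionLaplacian.DirectCorrelationStableTail) : IsingEuclidUpgrade.IsingEuclidUpgradeR2RotInvPowerLaw :=
  Summit.CriticalPhenomena.Ising3DConformalLimit.Theorems.SpineGlue.twoPointSpineGlue_proof hH (hT hH)
    Summit.CriticalPhenomena.Ising3DConformalLimit.Cruxes.StableConeRPRigidity.EntireProfileNullGrowth.StableConeRPRigidity_proof
    PrecisionLaplacian.CriticalCorrNineMirrorRP_holds

/-- Along the first axis the two-point law reads `G(n e₁) n^{2Δ} → c`. [folklore] -/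
theorem twoPointLaw_axis {Δ c : ℝ}
    (hT : Filter.Tendsto (fun x : Site 3 => criticalTwoPoint 3 x * Real.sqrt (∑ i, ((x i : ℝ)) ^ 2) ^ (2 * Δ))
      Filter.cofinite (nhds c)) :
    Tendsto (fun n : ℕ => criticalTwoPoint 3 (Pi.single 0 (n : ℤ)) * (n : ℝ) ^ (2 * Δ)) atTop (𝓝 c) := by
  have h := hT.comp tendsto_natCast_single_axis_cofinite
  refine h.congr fun n => ?_
  simp only [Function.comp_apply]
  rw [sqrt_sum_sq_single_axis]
  push_cast
  rw [abs_of_nonneg (Nat.cast_nonneg n)]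

/-! ## Everything below is MODULO the registered stub S6 `stub_levyContinuityTransfer` (section hypothesis `hS6`, its
registered statement verbatim); the unconditional versions follow in one line each once S6 lands. -/

section ModuloS6

variable (hS6 :
    ∀ (m : Site 3 → ℝ) (α c' C C' : ℝ) (R₁ : ℕ),
    Summable m → (∀ y, y ≠ 0 → 0 ≤ m y) → (∀ y, m (-y) = m y) → 0 < α → α < 2 → 0 < c' →
    (∀ R : ℕ, R₁ ≤ R → ∀ T : Finset (Site 3), (∀ y ∈ T, (R : ℝ) ≤ ‖y‖) → (R : ℝ) ^ α * ∑ y ∈ T, m y ≤ C) →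
    (∀ R : ℕ, 1 ≤ R → ∑ y ∈ box 3 R, m y * (∑ i, ((y i : ℝ)) ^ 2) ≤ C' * (R : ℝ) ^ (2 - α)) →
    (∀ k : Fin 3 → ℝ,
    Filter.Tendsto (fun R : ℕ => (R : ℝ) ^ α * ∑' y : Site 3, m y * (1 - Real.cos (∑ i, k i * ((y i : ℝ) / R))))
    Filter.atTop (nhds (c' * Real.sqrt (∑ i, k i ^ 2) ^ α))) →
    ∃ Φ₀ : ℝ, 0 < Φ₀ ∧ ∀ f : (Fin 3 → ℝ) → ℝ, Continuous f → HasCompactSupport f → (0 : Fin 3 → ℝ) ∉ tsupport f →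
    Filter.Tendsto (fun R : ℕ => (R : ℝ) ^ α * ∑' x : Site 3, m x * f (fun j => (x j : ℝ) / (R : ℝ)))
    Filter.atTop (nhds (∫ y : Fin 3 → ℝ, f y * (Φ₀ * Real.sqrt (∑ l, y l ^ 2) ^ (-(3 + α))))))
include hS6

/-! ## The composition: 1342 ∧ 0634 → S0 → S1 → S5(S2,S3,S4) → S6 → landed closure → crux, BY NAME -/

/-- **The skeleton closes the crux modulo the registered stubs and the named items 1342 and 0634.**  From NonSaturation
(`PerfectScreening.NonSaturation`, item 1342, by name) and the isotropic pure power law of the critical two-point function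
(`IsingEuclidUpgrade.IsingEuclidUpgradeR2RotInvPowerLaw`, item 0634, by name): S0 gives the exponent window and the scale
bounds; the proved dictionary item `PrecisionIsLaplacian` gives `m ∈ ℓ¹`, `Σ m = 0`, `m ≥ 0` off `0` and `m ∗ G = −δ`; the landed
`stub_dcfStructure`, `stub_pickInversion`, `stub_slabSpectralRepresentation` (line self-energy-pick-inversion) give the symmetries
and the antitone slab sums, the landed `stub_boxCapture` (this line) box capture; S1 gives tightness; S5 (fed with S2, S3, S4)
the symbol convergence; S6 the stable Lévy scaling with the isotropic profile `Φ ≡ Φ₀ > 0`; the landed closure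
`SelfEnergyPickInversion.stub_closureModuloStableScaling` (p126257) concludes the crux by name. -/
theorem DirectCorrelationStableTail_of_levyContinuity
    (hNS : PerfectScreening.NonSaturation)
    (hR2 : IsingEuclidUpgrade.IsingEuclidUpgradeR2RotInvPowerLaw) :
    Summit.CriticalPhenomena.Ising3DConformalLimit.Theses.PrecisionLaplacian.DirectCorrelationStableTail := by
  refine SelfEnergyPickInversion.stub_closureModuloStableScaling ?_
  intro hH
  -- the direct correlation function (the crux's inlined `iInf`) and the kernel
  set a : Site 3 → ℝ := fun x : Site 3 => (⨅ A : {A : Finset (Site 3) // (0 : Site 3) ∈ A ∧ x ∈ A},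
    -((Matrix.of fun (p q : ↥A.1) => criticalTwoPoint 3 (q.1 - p.1))⁻¹ ⟨0, A.2.1⟩ ⟨x, A.2.2⟩)) with ha
  -- the dictionary (item 4803, proved)
  obtain ⟨hsum, hzero, hnn, -, hconv⟩ :=
    Summit.CriticalPhenomena.Ising3DConformalLimit.Theorems.PrecisionIsLaplacian_proof hH
  -- symmetries and antitone slab sums (landed, line self-energy-pick-inversion)
  obtain ⟨-, -, hflip⟩ := SelfEnergyPickInversion.stub_dcfStructure hH
  have heven : ∀ x : Site 3, a (-x) = a x := fun x => SelfEnergyPickInversion.even_of_coordinate_flips (a := a) hflip x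
  have hHaus := SelfEnergyPickInversion.stub_pickInversion hH hsum SelfEnergyPickInversion.stub_slabSpectralRepresentation
  have hanti : ∀ (i : Fin 3) (n : ℕ), 1 ≤ n →
      (∑' y : Fin 2 → ℤ, a (Fin.insertNth i ((n + 1 : ℕ) : ℤ) (y) : Site 3)) ≤
        ∑' y : Fin 2 → ℤ, a (Fin.insertNth i (n : ℤ) (y) : Site 3) :=
    fun i => (SelfEnergyPickInversion.slab_tsum_antitone_of_hausdorff (a := a) i (hHaus i)).2
  -- the kernel: nonnegative, bounded by one, even
  have hG0 : ∀ x : Site 3, 0 ≤ criticalTwoPoint 3 x := criticalTwoPoint_nonneg'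
  have hG1 : ∀ x : Site 3, criticalTwoPoint 3 x ≤ 1 := criticalTwoPoint_le_one'
  have hGe : ∀ x : Site 3, criticalTwoPoint 3 (-x) = criticalTwoPoint 3 x := criticalTwoPoint_neg
  -- S0: the exponent window and the scale bounds
  obtain ⟨α, c, c₁, C₁, R₀, hα1, hα2, hc, hc₁, hT, hup, hlo⟩ := stub_exponentWindow hNS hR2
  -- S1: tightness
  obtain ⟨C, C', R₁, hinf, hzer⟩ := stub_tightness a (criticalTwoPoint 3) α c₁ C₁ R₀ hsum hzero hnn hflip hanti hconv
    stub_boxCapture hG0 hα1 hα2 hc₁ hup hlo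
  -- S5 (with S2, S3, S4): the rescaled symbol converges
  obtain ⟨c', hc', hψ⟩ := stub_symbolIdentification a (criticalTwoPoint 3) α c C C' R₁ hsum hzero hnn heven hG0 hG1 hGe
    hconv hα1 hα2 hc hinf hzer stub_scaleIdentity
    (fun t k ht => stub_kernelScaling (criticalTwoPoint 3) α c t k hG0 hG1 hGe hα1 hα2 hc ht hT)
    (stub_rieszGaussian α hα1 hα2)
  -- S6: stable Lévy scaling with the isotropic profile
  obtain ⟨Φ₀, hΦ₀, hscal⟩ := hS6 a α c' C C' R₁ hsum hnn heven (by linarith) hα2 hc' hinf hzer hψ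
  refine ⟨α, fun _ => Φ₀, hα1, hα2, continuousOn_const, fun _ _ => hΦ₀.le, ⟨Pi.single 0 1, ?_, hΦ₀⟩, ?_⟩
  · simp [Fin.sum_univ_three]
  · intro f hf hfc hf0
    exact hscal f hf hfc hf0

/-- **Headline of rev c4-1.**  Under `H`, the crux `DirectCorrelationStableTail` is EQUIVALENT to the conjunction of the
sub-problem's two central two-point items: the isotropic pure power law 0634 and NonSaturation 1342 (⇒: 4805 + r4 + RP9 and the
landed D1 `stub_nonSaturationOfStableTail`; ⇐: this skeleton). -/
theorem directCorrelationStableTail_iff_twoPointLaw_and_nonSaturation_of_levyContinuity (hH : ∀ A : Finset (Site 3), (Matrix.of fun (p q : ↥A) => criticalTwoPoint 3 (q.1 - p.1)).PosDef ∧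
      ∀ u v : ↥A, (u ≠ v → (Matrix.of fun (p q : ↥A) => criticalTwoPoint 3 (q.1 - p.1))⁻¹ u v ≤ 0) ∧
        0 ≤ ∑ w, (Matrix.of fun (p q : ↥A) => criticalTwoPoint 3 (q.1 - p.1))⁻¹ u w) :
    PrecisionLaplacian.DirectCorrelationStableTail ↔
      (IsingEuclidUpgrade.IsingEuclidUpgradeR2RotInvPowerLaw ∧ PerfectScreening.NonSaturation) :=
  ⟨fun hT => ⟨twoPointLaw_of_directCorrelationStableTail hH hT, stub_nonSaturationOfStableTail hH hT⟩,
    fun h => DirectCorrelationStableTail_of_levyContinuity hS6 h.2 h.1⟩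


/-- **Under `H`, item 0634 alone DECIDES the crux.**  If `G(x)|x|₂^{2Δ} → c > 0` (the conclusion of item 0634 with its
witnesses), then: `Δ > 1/2` gives `n G(n e₁) → 0`, hence NonSaturation and the crux (`DirectCorrelationStableTail_of_levyContinuity`);
`Δ ≤ 1/2` (so `Δ = 1/2`, `twoPointLaw_exponent_mem_Icc`) gives saturation `n G(n e₁) → c > 0`, contradicting the
NonSaturation that the crux implies under `H` (landed D1 `stub_nonSaturationOfStableTail`): the crux FAILS. -/
theorem directCorrelationStableTail_decided_by_twoPointLaw_of_levyContinuity
    (hH : ∀ A : Finset (Site 3), (Matrix.of fun (p q : ↥A) => criticalTwoPoint 3 (q.1 - p.1)).PosDef ∧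
      ∀ u v : ↥A, (u ≠ v → (Matrix.of fun (p q : ↥A) => criticalTwoPoint 3 (q.1 - p.1))⁻¹ u v ≤ 0) ∧
        0 ≤ ∑ w, (Matrix.of fun (p q : ↥A) => criticalTwoPoint 3 (q.1 - p.1))⁻¹ u w)
    {Δ c : ℝ} (hc : 0 < c)
    (hT : Filter.Tendsto (fun x : Site 3 => criticalTwoPoint 3 x * Real.sqrt (∑ i, ((x i : ℝ)) ^ 2) ^ (2 * Δ))
      Filter.cofinite (nhds c)) :
    (1 / 2 < Δ → PrecisionLaplacian.DirectCorrelationStableTail) ∧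
      (Δ ≤ 1 / 2 → ¬ PrecisionLaplacian.DirectCorrelationStableTail) := by
  have hax := twoPointLaw_axis hT
  -- `n G(n e₁) = [G(n e₁) n^{2Δ}] · n^{1 − 2Δ}` for `n ≥ 1`
  have hprod : ∀ s : ℝ, (fun n : ℕ => criticalTwoPoint 3 (Pi.single 0 (n : ℤ)) * (n : ℝ) ^ (2 * Δ) * (n : ℝ) ^ s)
      =ᶠ[atTop] fun n : ℕ => (n : ℝ) ^ (2 * Δ + s) * criticalTwoPoint 3 (Pi.single 0 (n : ℤ)) := by
    intro s
    filter_upwards [Filter.eventually_ge_atTop 1] with n hn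
    have hnpos : (0 : ℝ) < n := by exact_mod_cast hn
    rw [Real.rpow_add hnpos]
    ring
  constructor
  · intro hΔ
    refine DirectCorrelationStableTail_of_levyContinuity hS6 (fun ε hε => ?_) ⟨Δ, c, hc, hT⟩
    have h1 : Tendsto (fun n : ℕ => (n : ℝ) ^ (1 - 2 * Δ)) atTop (𝓝 0) := by
      have h := (tendsto_rpow_neg_atTop (by linarith : 0 < 2 * Δ - 1)).comp tendsto_natCast_atTop_atTop
      refine h.congr fun n => ?_
      simp only [Function.comp_apply]
      congr 1
      ring
    have h0 : Tendsto (fun n : ℕ => (n : ℝ) * criticalTwoPoint 3 (Pi.single 0 (n : ℤ))) atTop (𝓝 0) := by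
      have h := (hax.mul h1).congr' (hprod (1 - 2 * Δ))
      rw [mul_zero] at h
      refine h.congr fun n => ?_
      rw [show 2 * Δ + (1 - 2 * Δ) = (1 : ℝ) by ring, Real.rpow_one]
    exact (h0.eventually (gt_mem_nhds hε)).frequently
  · intro hΔ hcrux
    have hΔeq : Δ = 1 / 2 := le_antisymm hΔ (twoPointLaw_exponent_mem_Icc hc hT).1
    have hNS := stub_nonSaturationOfStableTail hH hcrux
    have hsat : Tendsto (fun n : ℕ => (n : ℝ) * criticalTwoPoint 3 (Pi.single 0 (n : ℤ))) atTop (𝓝 c) := by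
      refine hax.congr fun n => ?_
      rw [hΔeq, show 2 * (1 / 2 : ℝ) = 1 by norm_num, Real.rpow_one, mul_comm]
    have hev : ∀ᶠ n : ℕ in atTop, c / 2 < (n : ℝ) * criticalTwoPoint 3 (Pi.single 0 (n : ℤ)) :=
      hsat.eventually (lt_mem_nhds (by linarith))
    obtain ⟨n, hn1, hn2⟩ := ((hNS (c / 2) (half_pos hc)).and_eventually hev).exists
    linarith


/-- **Headline, one-item form.**  Under `H`, the crux `DirectCorrelationStableTail` is EQUIVALENT to the isotropic pure power
law of the critical two-point function WITH EXPONENT `Δ > 1/2` (item 0634's conclusion with its `Δ`-witness in `(1/2, 1]`):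
NonSaturation is then automatic (`directCorrelationStableTail_decided_by_twoPointLaw_of_levyContinuity`), and conversely the crux gives 0634
(4805 + r4 + RP9) whose witness `Δ ∈ [1/2, 1]` (`twoPointLaw_exponent_mem_Icc`) cannot be `1/2` because the crux also gives
NonSaturation (D1). -/
theorem directCorrelationStableTail_iff_twoPointLaw_gt_half_of_levyContinuity
    (hH : ∀ A : Finset (Site 3), (Matrix.of fun (p q : ↥A) => criticalTwoPoint 3 (q.1 - p.1)).PosDef ∧
      ∀ u v : ↥A, (u ≠ v → (Matrix.of fun (p q : ↥A) => criticalTwoPoint 3 (q.1 - p.1))⁻¹ u v ≤ 0) ∧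
        0 ≤ ∑ w, (Matrix.of fun (p q : ↥A) => criticalTwoPoint 3 (q.1 - p.1))⁻¹ u w) :
    PrecisionLaplacian.DirectCorrelationStableTail ↔
      ∃ Δ c : ℝ, 1 / 2 < Δ ∧ 0 < c ∧ Filter.Tendsto (fun x : Site 3 => criticalTwoPoint 3 x *
        Real.sqrt (∑ i, ((x i : ℝ)) ^ 2) ^ (2 * Δ)) Filter.cofinite (nhds c) := by
  constructor
  · intro hT
    obtain ⟨Δ, c, hc, hlaw⟩ := twoPointLaw_of_directCorrelationStableTail hH hT
    refine ⟨Δ, c, ?_, hc, hlaw⟩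
    rcases lt_or_ge (1 / 2 : ℝ) Δ with h | h
    · exact h
    · exact absurd hT ((directCorrelationStableTail_decided_by_twoPointLaw_of_levyContinuity hS6 hH hc hlaw).2 h)
  · rintro ⟨Δ, c, hΔ, hc, hlaw⟩
    exact (directCorrelationStableTail_decided_by_twoPointLaw_of_levyContinuity hS6 hH hc hlaw).1 hΔ


end ModuloS6

/-- **Registered bookkeeping stub `stub_closureModuloLevyContinuity`: the crux is closed modulo S6 and the named items 1342, 0634.**
Hypotheses: the registered statement of `stub_levyContinuityTransfer` (verbatim), NonSaturation (item 1342) and the isotropic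
pure power law (item 0634); conclusion: the crux by name (`DirectCorrelationStableTail_of_levyContinuity`). -/
theorem stub_closureModuloLevyContinuity :
    (∀ (m : Site 3 → ℝ) (α c' C C' : ℝ) (R₁ : ℕ),
      Summable m → (∀ y, y ≠ 0 → 0 ≤ m y) → (∀ y, m (-y) = m y) → 0 < α → α < 2 → 0 < c' →
      (∀ R : ℕ, R₁ ≤ R → ∀ T : Finset (Site 3), (∀ y ∈ T, (R : ℝ) ≤ ‖y‖) → (R : ℝ) ^ α * ∑ y ∈ T, m y ≤ C) →
      (∀ R : ℕ, 1 ≤ R → ∑ y ∈ box 3 R, m y * (∑ i, ((y i : ℝ)) ^ 2) ≤ C' * (R : ℝ) ^ (2 - α)) →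
      (∀ k : Fin 3 → ℝ,
      Filter.Tendsto (fun R : ℕ => (R : ℝ) ^ α * ∑' y : Site 3, m y * (1 - Real.cos (∑ i, k i * ((y i : ℝ) / R))))
      Filter.atTop (nhds (c' * Real.sqrt (∑ i, k i ^ 2) ^ α))) →
      ∃ Φ₀ : ℝ, 0 < Φ₀ ∧ ∀ f : (Fin 3 → ℝ) → ℝ, Continuous f → HasCompactSupport f → (0 : Fin 3 → ℝ) ∉ tsupport f →
      Filter.Tendsto (fun R : ℕ => (R : ℝ) ^ α * ∑' x : Site 3, m x * f (fun j => (x j : ℝ) / (R : ℝ)))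
      Filter.atTop (nhds (∫ y : Fin 3 → ℝ, f y * (Φ₀ * Real.sqrt (∑ l, y l ^ 2) ^ (-(3 + α)))))) →
    PerfectScreening.NonSaturation → IsingEuclidUpgrade.IsingEuclidUpgradeR2RotInvPowerLaw →
    PrecisionLaplacian.DirectCorrelationStableTail :=
  fun hS6 hNS hR2 => DirectCorrelationStableTail_of_levyContinuity hS6 hNS hR2

end Summit.CriticalPhenomena.Ising3DConformalLimit.Cruxes.DirectCorrelationStableTail.DiffusiveBranchIsNonsaturation

end
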